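import Literature.Analysis.FluidPDE.Seregin2020SwirlEquationOffAxis
import Literature.Analysis.FluidPDE.LeiZhang2011Proofs
import Literature.Analysis.FluidPDE.ClassicalSuitableRegion
import Literature.Analysis.FluidPDE.CylinderInversion
import Literature.Analysis.FluidPDE.IntegratedChainRule
import HarnessLib

/-!
# Seregin 2020, proof of Thm. 2.1: the energy inequality for the swirl off the axis

Analysis/FluidPDE proofs file (theorems only; no definitions, no named facts), on the discharge
path of the named fact `Literature.Analysis.FluidPDE.Seregin2020_axisymmetricSingularPoint_typeII`
(G. Seregin, *Local regularity of axisymmetric solutions to the Navier–Stokes equations*, Anal.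
Math. Phys. 10 (2020), Paper No. 46 = arXiv:2006.04140, Thm. 2.1).

The printed proof of Thm. 2.1 (arXiv pp. 4–5) multiplies the swirl equation (2.2)
`∂ₜσ + (v + b)·∇σ - Δσ = 0`, `b = 2(x', 0)/|x'|²`, valid off the axis, by `σ_N^{2m-1} ψ⁴ φ²`
(`φ` a cut-off of the axis, `ψ` a cut-off of the parabolic boundary) and integrates by parts:
"As a result, three different terms appear and they will be treated separately … Combining
previous relationships, we find the following energy inequality". This file proves that energy
inequality in the convex-function form of Lei–Zhang 2011, §2 (2.2)–(2.4) (the tree's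
`LeiZhang2011.energy_identity` / `energy_inequality`, there for globally smooth solutions): the
equation is tested with `H'(σ) η(t) Θ(x)²` for a convex `H ∈ C²` and a cut-off `Θ ∈ C¹_c`
supported OFF the axis, inside the region where the solution is smooth.

* Tools: integration by parts against a field which is `C¹` and divergence free only on an open
  set containing the support of the test function
  (`integral_inner_gradient_eq_zero_of_divergence_eq_zero_of_subset`), Green's identity for a
  function `C²` only there (`integral_laplacian_mul_deriv_comp_mul_sq_of_contDiffOn`) — both by
  a smooth cut-off `≡ 1` near the support —, and the drift `b = (2/ϱ) e_ϱ = 2x'/|x'|²`: smooth and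
  DIVERGENCE FREE off the axis (`divergence_axisDrift_eq_zero`; this is why `b` can be moved onto
  the cut-off exactly like `v`, as in the display "`∫(v+b)·∇σ σ_N^{2m-1}ψ⁴φ² = -(1/2m)∫(v+b)·∇(ψ⁴φ²)σ_N^{2m} - …`"
  of the paper).
* `Seregin2020.swirl_energy_slice_identity` — at a fixed time, for the class
  `IsSmoothAxisymmetricSolutionOn (]lo,hi[ × U)` with `U` off the axis:
  `∫ H'(σ) (∂ₜσ) Θ² = -∫ H''(σ)|∇σ|²Θ² - ∫ H'(σ)⟪∇σ, ∇Θ²⟫ + ∫ H(σ)⟪V, ∇Θ²⟫ + ∫ (2/ϱ)H(σ)∂_ϱ(Θ²)`.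
* `Seregin2020.swirl_energy_identity` — integrated in time against `η(t)`.
* `Seregin2020.swirl_energy_inequality` — with `H'² ≤ 2HH''` (the viscous cross term absorbed:
  `|∫H'(σ)⟪∇σ,∇Θ²⟫| ≤ ½∫H''|∇σ|²Θ² + 4∫H|∇Θ|²`), `η ≥ 0`, `η(t₁) = 0`:
  `η(t)∫H(σ(t))Θ² + ½∫_{t₁}^t η∫H''(σ)|∇σ|²Θ² ≤ ∫_{t₁}^t (4η∫H(σ)|∇Θ|² + η∫H(σ)⟪V,∇Θ²⟫ + η∫(2/ϱ)H(σ)∂_ϱΘ² + |η'|∫H(σ)Θ²)`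
  — Seregin's energy inequality (arXiv p. 5, the display before "Now, selecting a special
  non-negative cut-off function") in this form.

## References

* G. Seregin, Anal. Math. Phys. 10 (2020), Paper 46 = arXiv:2006.04140, proof of Thm. 2.1,
  pp. 4–5 (the energy inequality). [`Seregin2020`]
* Z. Lei, Q. S. Zhang, J. Funct. Anal. 261 (2011) 2323–2345 = arXiv:1011.5066, §2 (2.2)–(2.4).
  [`LeiZhang2011`]
-/

noncomputable section

open MeasureTheory Set Function Filter Topology TopologicalSpace Metric WithLp intervalIntegral
open scoped NNReal ENNReal ContDiff InnerProductSpace RealInnerProductSpace Laplacian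

namespace Literature.Analysis.FluidPDE

namespace Seregin2020

open SereginZajaczkowski2007 SereginSverak2009

/-! ### Integration by parts against fields regular only near the support -/

/-- **Weak divergence-free condition, localised.** If `X` is `C¹` and divergence free on an open
set `O` and `ψ ∈ C¹_c` has `tsupport ψ ⊆ O`, then `∫ ⟪X, ∇ψ⟫ = 0` (the tree's
`integral_inner_gradient_eq_zero_of_divergence_eq_zero` applied to `χ • X` for a smooth `χ` with
`tsupport χ ⊆ O`, `χ = 1` near `tsupport ψ`). [folklore] -/
theorem integral_inner_gradient_eq_zero_of_divergence_eq_zero_of_subset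
    {O : Set (EuclideanSpace ℝ (Fin 3))} (hO : IsOpen O)
    {X : EuclideanSpace ℝ (Fin 3) → EuclideanSpace ℝ (Fin 3)} (hX : ContDiffOn ℝ 1 X O)
    (hdiv : ∀ x ∈ O, VectorCalculus.divergence X x = 0)
    {ψ : EuclideanSpace ℝ (Fin 3) → ℝ} (hψ : ContDiff ℝ 1 ψ) (hψc : HasCompactSupport ψ)
    (hψO : tsupport ψ ⊆ O) :
    ∫ x, ⟪X x, gradient ψ x⟫ = 0 := by
  obtain ⟨χ, hχ, -, hχO, hχ1⟩ :=
    exists_contDiff_tsupport_subset_eventuallyEq_one (K := tsupport ψ) hψc hO hψO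
  set Xt : EuclideanSpace ℝ (Fin 3) → EuclideanSpace ℝ (Fin 3) := fun x => χ x • X x with hXt
  have hXtC : ContDiff ℝ 1 Xt :=
    contDiff_cutoff_smul_of_contDiffOn hO (hχ.of_le (by norm_cast)) hχO hX
  have hnhds : ∀ x ∈ tsupport ψ, Xt =ᶠ[𝓝 x] X := by
    intro x hx
    filter_upwards [hχ1.filter_mono (nhds_le_nhdsSet hx)] with y hy
    simp only [hXt, hy, one_smul]
  have hdivt : ∀ x ∈ tsupport ψ, VectorCalculus.divergence Xt x = 0 := by
    intro x hx
    have e : VectorCalculus.divergence Xt x = VectorCalculus.divergence X x := by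
      simp only [VectorCalculus.divergence, (hnhds x hx).fderiv_eq]
    rw [e]
    exact hdiv x (hψO hx)
  have h := integral_inner_gradient_eq_zero_of_divergence_eq_zero hXtC hψ hψc hdivt
  rw [← h]
  refine integral_congr_ae (ae_of_all _ fun x => ?_)
  beta_reduce
  by_cases hx : x ∈ tsupport ψ
  · rw [(hnhds x hx).self_of_nhds]
  · rw [gradient_eq_zero_of_notMem_tsupport hx, inner_zero_right, inner_zero_right]

/-- **Green's first identity with the test function `H'(F) φ²`, localised**: the tree's
`LeiZhang2011.integral_laplacian_mul_deriv_comp_mul_sq`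
(`∫ ΔF · H'(F) φ² = -∫ H''(F)‖∇F‖²φ² - ∫ H'(F)⟪∇F, ∇φ²⟫`) for `F` of class `C²` only on an open
set `O ⊇ tsupport φ` (applied to `χ F` for a smooth `χ` supported in `O` with `χ = 1` near
`tsupport φ`; `F`, `∇F`, `ΔF` are unchanged near `tsupport φ`). [folklore] -/
theorem integral_laplacian_mul_deriv_comp_mul_sq_of_contDiffOn
    {O : Set (EuclideanSpace ℝ (Fin 3))} (hO : IsOpen O) {F : EuclideanSpace ℝ (Fin 3) → ℝ}
    (hF : ContDiffOn ℝ 2 F O) {H : ℝ → ℝ} (hH : ContDiff ℝ 2 H)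
    {φ : EuclideanSpace ℝ (Fin 3) → ℝ} (hφ : ContDiff ℝ 1 φ) (hφc : HasCompactSupport φ)
    (hφO : tsupport φ ⊆ O) :
    ∫ x, deriv H (F x) * φ x ^ 2 * (Δ F) x =
      -∫ x, (deriv (deriv H) (F x) * ‖gradient F x‖ ^ 2 * φ x ^ 2 +
        deriv H (F x) * ⟪gradient F x, gradient (fun y => φ y ^ 2) x⟫) := by
  obtain ⟨χ, hχ, -, hχO, hχ1⟩ :=
    exists_contDiff_tsupport_subset_eventuallyEq_one (K := tsupport φ) hφc hO hφO
  set Ft : EuclideanSpace ℝ (Fin 3) → ℝ := fun x => χ x • F x with hFt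
  have hFtC : ContDiff ℝ 2 Ft :=
    contDiff_cutoff_smul_of_contDiffOn hO (hχ.of_le (by norm_cast)) hχO hF
  have hnhds : ∀ x ∈ tsupport φ, Ft =ᶠ[𝓝 x] F := by
    intro x hx
    filter_upwards [hχ1.filter_mono (nhds_le_nhdsSet hx)] with y hy
    simp only [hFt, hy, one_smul]
  -- the identity for `Ft`
  have h := integral_laplacian_mul_deriv_comp_mul_sq hFtC hH hφ hφc
  -- `φ²` and `∇φ²` vanish off `tsupport φ`
  have hφ0 : ∀ x, x ∉ tsupport φ → φ x = 0 := fun x hx => image_eq_zero_of_notMem_tsupport hx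
  have hgrad0 : ∀ x, x ∉ tsupport φ → gradient (fun y => φ y ^ 2) x = 0 := by
    intro x hx
    refine gradient_eq_zero_of_notMem_tsupport fun h => hx ?_
    exact (tsupport_smul_subset_left (fun y => φ y) (fun y => φ y)) (by simpa [sq] using h)
  -- transfer both sides
  have eL : ∫ x, deriv H (Ft x) * φ x ^ 2 * (Δ Ft) x = ∫ x, deriv H (F x) * φ x ^ 2 * (Δ F) x := by
    refine integral_congr_ae (ae_of_all _ fun x => ?_)
    beta_reduce
    by_cases hx : x ∈ tsupport φ
    · rw [(hnhds x hx).self_of_nhds, (InnerProductSpace.laplacian_congr_nhds (hnhds x hx)).self_of_nhds]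
    · simp only [hφ0 x hx]
      ring
  have eR' : ∫ x, (deriv (deriv H) (Ft x) * ‖gradient Ft x‖ ^ 2 * φ x ^ 2 +
        deriv H (Ft x) * ⟪gradient Ft x, gradient (fun y => φ y ^ 2) x⟫) =
      ∫ x, (deriv (deriv H) (F x) * ‖gradient F x‖ ^ 2 * φ x ^ 2 +
        deriv H (F x) * ⟪gradient F x, gradient (fun y => φ y ^ 2) x⟫) := by
    refine integral_congr_ae (ae_of_all _ fun x => ?_)
    beta_reduce
    by_cases hx : x ∈ tsupport φ
    · have hg : gradient Ft x = gradient F x := by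
        simp only [gradient, (hnhds x hx).fderiv_eq]
      rw [(hnhds x hx).self_of_nhds, hg]
    · simp only [hφ0 x hx, hgrad0 x hx, inner_zero_right]
      ring
  rw [← eL, h, eR']

/-! ### The drift `b = (2/ϱ) e_ϱ = 2x'/|x'|²` is smooth and divergence free off the axis -/

/-- The horizontal projection `x ↦ (x₀, x₁, 0)` has divergence `2`. [folklore] -/
theorem divergence_horizontalProjL (x : EuclideanSpace ℝ (Fin 3)) :
    VectorCalculus.divergence (horizontalProjL : EuclideanSpace ℝ (Fin 3) → EuclideanSpace ℝ (Fin 3)) x = 2 := by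
  rw [divergence_eq_sum_inner_fderiv (EuclideanSpace.basisFun (Fin 3) ℝ), horizontalProjL.fderiv]
  simp only [Fin.sum_univ_three, horizontalProjL_apply, inner_horizontalProj_right,
    EuclideanSpace.basisFun_apply, PiLp.single_apply]
  norm_num [Fin.ext_iff]

/-- Off the axis, `(2/ϱ) e_ϱ = 2 (ϱ²)⁻¹ x'` (with `x' = (x₀, x₁, 0)`). [folklore] -/
theorem two_div_cylRadius_smul_eR (x : EuclideanSpace ℝ (Fin 3)) :
    (2 / cylRadius x) • eR x = (2 * (cylRadius x ^ 2)⁻¹) • horizontalProjL x := by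
  rw [eR_eq_smul_horizontalProj, smul_smul, horizontalProjL_apply]
  congr 1
  rw [div_eq_mul_inv, sq, mul_inv, mul_assoc]

/-- **The drift `b(x) = (2/ϱ) e_ϱ(x) = 2x'/|x'|²` of the swirl equation is `C^∞` off the axis.**
[folklore] -/
theorem contDiffAt_axisDrift {x : EuclideanSpace ℝ (Fin 3)} (hx : cylRadius x ≠ 0) {n : WithTop ℕ∞} :
    ContDiffAt ℝ n (fun y : EuclideanSpace ℝ (Fin 3) => (2 / cylRadius y) • eR y) x := by
  have e : (fun y : EuclideanSpace ℝ (Fin 3) => (2 / cylRadius y) • eR y) =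
      fun y => (2 * (cylRadius y ^ 2)⁻¹) • horizontalProjL y := funext two_div_cylRadius_smul_eR
  rw [e]
  have hsq : ContDiff ℝ n fun y : EuclideanSpace ℝ (Fin 3) => cylRadius y ^ 2 := by
    have e2 : (fun y : EuclideanSpace ℝ (Fin 3) => cylRadius y ^ 2) = fun y => y 0 ^ 2 + y 1 ^ 2 :=
      funext cylRadius_sq
    rw [e2]
    exact contDiff_sq_add_sq
  have hq : cylRadius x ^ 2 ≠ 0 := pow_ne_zero 2 hx
  exact (contDiffAt_const.mul (hsq.contDiffAt.inv hq)).smul horizontalProjL.contDiff.contDiffAt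

/-- **The drift `b = (2/ϱ) e_ϱ = 2x'/|x'|²` is divergence free off the axis**:
`div b = 2(ϱ²)⁻¹ div x' + ⟪x', ∇(2(ϱ²)⁻¹)⟫ = 4/ϱ² - 4/ϱ² = 0` (in `ℝ³`, `x'/|x'|²` is the planar
gradient of `log |x'|`, harmonic off the axis). This is what allows the drift term
`∫ b·∇σ σ_N^{2m-1} ψ⁴φ²` of Seregin's computation to be integrated by parts onto the cut-off
(arXiv:2006.04140, p. 5, "Denoting `b = 2(x',0)|x'|⁻²`, transform the second term as follows").
[cite: Seregin2020, proof of Thm. 2.1 (arXiv p. 5), the term with b = 2(x',0)|x'|⁻²] -/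
theorem divergence_axisDrift_eq_zero {x : EuclideanSpace ℝ (Fin 3)} (hx : cylRadius x ≠ 0) :
    VectorCalculus.divergence (fun y : EuclideanSpace ℝ (Fin 3) => (2 / cylRadius y) • eR y) x = 0 := by
  have e : (fun y : EuclideanSpace ℝ (Fin 3) => (2 / cylRadius y) • eR y) =
      fun y => (2 * (cylRadius y ^ 2)⁻¹) • horizontalProjL y := funext two_div_cylRadius_smul_eR
  rw [e]
  have hq : cylRadius x ^ 2 ≠ 0 := pow_ne_zero 2 hx
  -- the derivative of `θ(y) = 2 (ϱ(y)²)⁻¹`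
  have hinv := (hasDerivAt_inv hq).comp_hasFDerivAt x (hasFDerivAt_cylRadius_sq' x)
  have hθd : HasFDerivAt (fun y : EuclideanSpace ℝ (Fin 3) => 2 * (cylRadius y ^ 2)⁻¹)
      ((2 : ℝ) • (-((cylRadius x ^ 2) ^ 2)⁻¹ • ((2 : ℕ) • (innerSL ℝ (horizontalProj x)).comp horizontalProjL))) x := by
    have h2 := hinv.const_smul (2 : ℝ)
    refine h2.congr_of_eventuallyEq (Eventually.of_forall fun y => ?_)
    simp [Function.comp, smul_eq_mul]
  rw [divergence_smul_apply hθd.differentiableAt horizontalProjL.differentiableAt,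
    divergence_horizontalProjL, real_inner_comm, inner_gradient_left, hθd.fderiv]
  simp only [FunLike.coe_smul, Pi.smul_apply, ContinuousLinearMap.comp_apply,
    innerSL_apply_apply, horizontalProjL_apply, horizontalProj_horizontalProj,
    inner_horizontalProj_horizontalProj_self, smul_eq_mul]
  simp only [nsmul_eq_mul, Nat.cast_ofNat]
  field_simp
  ring

/-- `⟪b, ∇F⟫ = (2/ϱ) ∂_ϱF` for the drift `b = (2/ϱ) e_ϱ`. [folklore] -/
theorem inner_axisDrift_gradient (F : EuclideanSpace ℝ (Fin 3) → ℝ) (x : EuclideanSpace ℝ (Fin 3)) :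
    ⟪(2 / cylRadius x) • eR x, gradient F x⟫ = 2 / cylRadius x * fderiv ℝ F x (eR x) := by
  rw [real_inner_comm, inner_gradient_left, map_smul, smul_eq_mul]

/-! ### Compactly supported integrands which are continuous only on an open set -/

/-- A function continuous on an open `W` and vanishing off a compact `K ⊆ W` is continuous and
integrable (it vanishes near every point outside `W`). [folklore] -/
theorem continuous_integrable_of_continuousOn_of_eq_zero {f : EuclideanSpace ℝ (Fin 3) → ℝ}
    {W K : Set (EuclideanSpace ℝ (Fin 3))} (hW : IsOpen W) (hK : IsCompact K) (hKW : K ⊆ W)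
    (hf : ContinuousOn f W) (h0 : ∀ x, x ∉ K → f x = 0) : Continuous f ∧ Integrable f := by
  have hc : Continuous f := by
    rw [continuous_iff_continuousAt]
    intro x
    by_cases hx : x ∈ W
    · exact hf.continuousAt (hW.mem_nhds hx)
    · have hxK : x ∉ K := fun h => hx (hKW h)
      have hev : f =ᶠ[𝓝 x] fun _ => 0 := by
        filter_upwards [hK.isClosed.isOpen_compl.mem_nhds hxK] with y hy
        exact h0 y hy
      exact continuousAt_const.congr hev.symm
  exact ⟨hc, hc.integrable_of_hasCompactSupport (HasCompactSupport.intro hK h0)⟩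

/-- `∇(Θ²)` vanishes off `tsupport Θ`. [folklore] -/
theorem gradient_sq_eq_zero_of_notMem {Θ : EuclideanSpace ℝ (Fin 3) → ℝ} {x : EuclideanSpace ℝ (Fin 3)}
    (hx : x ∉ tsupport Θ) : gradient (fun y => Θ y ^ 2) x = 0 :=
  gradient_eq_zero_of_notMem_tsupport fun h => hx (tsupport_mul_subset_right h)

/-- `D(Θ²)` vanishes off `tsupport Θ`. [folklore] -/
theorem fderiv_sq_eq_zero_of_notMem {Θ : EuclideanSpace ℝ (Fin 3) → ℝ} {x : EuclideanSpace ℝ (Fin 3)}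
    (hx : x ∉ tsupport Θ) : fderiv ℝ (fun y => Θ y ^ 2) x = 0 :=
  fderiv_of_notMem_tsupport ℝ fun h => hx (tsupport_mul_subset_right h)

/-- The gradient of a product of real functions: `∇(a c) = a ∇c + c ∇a`. [folklore] -/
theorem gradient_mul_apply' {a c : EuclideanSpace ℝ (Fin 3) → ℝ} {x : EuclideanSpace ℝ (Fin 3)}
    (ha : DifferentiableAt ℝ a x) (hc : DifferentiableAt ℝ c x) :
    gradient (fun y => a y * c y) x = a x • gradient c x + c x • gradient a x := by
  simp only [gradient, fderiv_fun_mul ha hc, map_add, map_smul]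

/-- The Laplacian of a function `C²` on an open set is continuous there. [folklore] -/
theorem continuousOn_laplacian_of_contDiffOn {F : EuclideanSpace ℝ (Fin 3) → ℝ}
    {O : Set (EuclideanSpace ℝ (Fin 3))} (hO : IsOpen O) (hF : ContDiffOn ℝ 2 F O) :
    ContinuousOn (Δ F) O := by
  rw [InnerProductSpace.laplacian_eq_iteratedFDeriv_orthonormalBasis F (EuclideanSpace.basisFun (Fin 3) ℝ)]
  refine continuousOn_finsetSum _ fun i _ => ?_
  have h := hF.continuousOn_iteratedFDerivWithin (m := 2) le_rfl hO.uniqueDiffOn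
  have h' : ContinuousOn (iteratedFDeriv ℝ 2 F) O :=
    h.congr fun x hx => (iteratedFDerivWithin_of_isOpen 2 hO hx).symm
  exact (continuous_eval_const _).comp_continuousOn h'

/-- The gradient of a function `C¹` on an open set is continuous there. [folklore] -/
theorem continuousOn_gradient_of_contDiffOn {F : EuclideanSpace ℝ (Fin 3) → ℝ}
    {O : Set (EuclideanSpace ℝ (Fin 3))} (hO : IsOpen O) (hF : ContDiffOn ℝ 1 F O) :
    ContinuousOn (gradient F) O := by
  have h := hF.continuousOn_fderiv_of_isOpen hO le_rfl
  exact (InnerProductSpace.toDual ℝ (EuclideanSpace ℝ (Fin 3))).symm.continuous.comp_continuousOn h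

/-! ### The slice identity for the swirl -/

section Slice

variable {V : ℝ → EuclideanSpace ℝ (Fin 3) → EuclideanSpace ℝ (Fin 3)} {P : ℝ → EuclideanSpace ℝ (Fin 3) → ℝ}
  {S : Opens (ℝ × EuclideanSpace ℝ (Fin 3))} {lo hi : ℝ} {U : Set (EuclideanSpace ℝ (Fin 3))}

/-- Points of `]lo, hi[ × U` lie in `S`. [folklore] -/
theorem mem_of_eq_prod (hSU : (S : Set (ℝ × EuclideanSpace ℝ (Fin 3))) = Ioo lo hi ×ˢ U) {s : ℝ}
    (hs : s ∈ Ioo lo hi) {x : EuclideanSpace ℝ (Fin 3)} (hx : x ∈ U) :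
    ((s, x) : ℝ × EuclideanSpace ℝ (Fin 3)) ∈ (S : Set (ℝ × EuclideanSpace ℝ (Fin 3))) := by
  rw [hSU]
  exact ⟨hs, hx⟩

/-- The swirl slices of the smooth class are `C²` on `U`. [folklore] -/
theorem contDiffOn_swirl_slice (hSU : (S : Set (ℝ × EuclideanSpace ℝ (Fin 3))) = Ioo lo hi ×ˢ U)
    (hV : IsSmoothAxisymmetricSolutionOn S V P) {s : ℝ} (hs : s ∈ Ioo lo hi) :
    ContDiffOn ℝ 2 (swirl (V s)) U := fun x hx =>
  ((hV.contDiffAt_swirl (z := (s, x)) (mem_of_eq_prod hSU hs hx)).of_le (by norm_cast)).contDiffWithinAt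

/-- The velocity slices of the smooth class are `C¹` on `U`. [folklore] -/
theorem contDiffOn_velocity_slice (hSU : (S : Set (ℝ × EuclideanSpace ℝ (Fin 3))) = Ioo lo hi ×ˢ U)
    (hV : IsSmoothAxisymmetricSolutionOn S V P) {s : ℝ} (hs : s ∈ Ioo lo hi) :
    ContDiffOn ℝ 1 (V s) U := fun x hx =>
  ((hV.contDiffAt (s, x) (mem_of_eq_prod hSU hs hx)).of_le (by norm_cast)).contDiffWithinAt

/-- **The slice identity of the energy method for the swirl** (Seregin 2020, proof of Thm. 2.1,
arXiv pp. 4–5: the three integrations by parts "for the first one … transform the second term …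
for the third term", at a fixed time; Lei–Zhang 2011, (2.2)–(2.3)). For the class
`IsSmoothAxisymmetricSolutionOn S`, `S = ]lo, hi[ × U` with `U` open and off the axis, a convex
profile `H ∈ C²` and a cut-off `Θ ∈ C¹_c` with `tsupport Θ ⊆ U`, at each time `s ∈ ]lo, hi[`:
`∫ H'(σ) (Δσ - Dσ[V] - (2/ϱ)∂_ϱσ) Θ² = -∫ (H''(σ)|∇σ|²Θ² + H'(σ)⟪∇σ, ∇Θ²⟫) + ∫ H(σ)⟪V, ∇Θ²⟫ + ∫ (2/ϱ) H(σ) ∂_ϱ(Θ²)`,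
`σ = swirl (V s)` (Green's identity; `div V = 0` and `div b = 0`, `b = (2/ϱ)e_ϱ`, on `U`).
[cite: Seregin2020, proof of Thm. 2.1 (arXiv pp. 4–5), the three integrations by parts] -/
theorem swirl_energy_slice_identity (hU : IsOpen U)
    (hSU : (S : Set (ℝ × EuclideanSpace ℝ (Fin 3))) = Ioo lo hi ×ˢ U)
    (hUρ : ∀ x ∈ U, cylRadius x ≠ 0) (hV : IsSmoothAxisymmetricSolutionOn S V P)
    {H : ℝ → ℝ} (hH : ContDiff ℝ 2 H)
    {Θ : EuclideanSpace ℝ (Fin 3) → ℝ} (hΘ : ContDiff ℝ 1 Θ) (hΘc : HasCompactSupport Θ)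
    (hΘU : tsupport Θ ⊆ U) {s : ℝ} (hs : s ∈ Ioo lo hi) :
    ∫ x, deriv H (swirl (V s) x) * ((Δ (swirl (V s))) x - fderiv ℝ (swirl (V s)) x (V s x) -
        2 / cylRadius x * partialDeriv (eR x) (swirl (V s)) x) * Θ x ^ 2 =
      -(∫ x, (deriv (deriv H) (swirl (V s) x) * ‖gradient (swirl (V s)) x‖ ^ 2 * Θ x ^ 2 +
          deriv H (swirl (V s) x) * ⟪gradient (swirl (V s)) x, gradient (fun y => Θ y ^ 2) x⟫)) +
      (∫ x, H (swirl (V s) x) * ⟪V s x, gradient (fun y => Θ y ^ 2) x⟫) +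
      ∫ x, 2 / cylRadius x * (H (swirl (V s) x) * fderiv ℝ (fun y => Θ y ^ 2) x (eR x)) := by
  -- notation and regularity on `U`
  set F : EuclideanSpace ℝ (Fin 3) → ℝ := swirl (V s) with hFdef
  set K : Set (EuclideanSpace ℝ (Fin 3)) := tsupport Θ with hKdef
  have hK : IsCompact K := hΘc
  have hF2 : ContDiffOn ℝ 2 F U := contDiffOn_swirl_slice hSU hV hs
  have hF1 : ContDiffOn ℝ 1 F U := hF2.of_le (by norm_cast)
  have hV1 : ContDiffOn ℝ 1 (V s) U := contDiffOn_velocity_slice hSU hV hs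
  have hdivV : ∀ x ∈ U, VectorCalculus.divergence (V s) x = 0 := fun x hx =>
    hV.divergence_eq_zero (z := (s, x)) (mem_of_eq_prod hSU hs hx)
  have hH1 : ContDiff ℝ 1 H := hH.of_le one_le_two
  have hH' : ContDiff ℝ 1 (deriv H) := by
    have h2 : ContDiff ℝ (1 + 1) H := by rw [one_add_one_eq_two]; exact hH
    exact h2.deriv'
  -- continuity on `U` of the building blocks
  have cF : ContinuousOn F U := hF2.continuousOn
  have cHF : ContinuousOn (fun x => H (F x)) U := hH.continuous.comp_continuousOn cF
  have cH'F : ContinuousOn (fun x => deriv H (F x)) U := hH'.continuous.comp_continuousOn cF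
  have cH''F : ContinuousOn (fun x => deriv (deriv H) (F x)) U :=
    (hH'.continuous_deriv le_rfl).comp_continuousOn cF
  have cΔF : ContinuousOn (Δ F) U := continuousOn_laplacian_of_contDiffOn hU hF2
  have cgradF : ContinuousOn (gradient F) U := continuousOn_gradient_of_contDiffOn hU hF1
  have cfderivF : ContinuousOn (fderiv ℝ F) U := hF1.continuousOn_fderiv_of_isOpen hU le_rfl
  have cV : ContinuousOn (V s) U := hV1.continuousOn
  have ceR : ContinuousOn eR U := continuousOn_eR_offAxis.mono fun x hx => hUρ x hx
  have cinv : ContinuousOn (fun x => 2 / cylRadius x) U :=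
    continuousOn_const.div continuous_cylRadius.continuousOn fun x hx => hUρ x hx
  have cΘ : Continuous Θ := hΘ.continuous
  have cΘ2 : Continuous fun y => Θ y ^ 2 := cΘ.pow 2
  have hΘ2 : ContDiff ℝ 1 fun y => Θ y ^ 2 := hΘ.pow 2
  have cgradΘ2 : Continuous (gradient fun y => Θ y ^ 2) := continuous_gradient_of_contDiff hΘ2
  have cfderivΘ2 : Continuous (fderiv ℝ fun y => Θ y ^ 2) := hΘ2.continuous_fderiv one_ne_zero
  -- vanishing off `K`
  have hΘ0 : ∀ x, x ∉ K → Θ x = 0 := fun x hx => image_eq_zero_of_notMem_tsupport hx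
  have hgΘ0 : ∀ x, x ∉ K → gradient (fun y => Θ y ^ 2) x = 0 := fun x hx => gradient_sq_eq_zero_of_notMem hx
  have hfΘ0 : ∀ x, x ∉ K → fderiv ℝ (fun y => Θ y ^ 2) x = 0 := fun x hx => fderiv_sq_eq_zero_of_notMem hx
  -- the five integrands and their integrability
  set P₁ : EuclideanSpace ℝ (Fin 3) → ℝ := fun x => deriv H (F x) * Θ x ^ 2 * (Δ F) x with hP₁
  set P₂ : EuclideanSpace ℝ (Fin 3) → ℝ := fun x => ⟪V s x, gradient F x⟫ * (deriv H (F x) * Θ x ^ 2) with hP₂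
  set P₃ : EuclideanSpace ℝ (Fin 3) → ℝ := fun x =>
    2 / cylRadius x * (fderiv ℝ F x (eR x) * (deriv H (F x) * Θ x ^ 2)) with hP₃
  set P₄ : EuclideanSpace ℝ (Fin 3) → ℝ := fun x => H (F x) * ⟪V s x, gradient (fun y => Θ y ^ 2) x⟫ with hP₄
  set P₅ : EuclideanSpace ℝ (Fin 3) → ℝ := fun x =>
    2 / cylRadius x * (H (F x) * fderiv ℝ (fun y => Θ y ^ 2) x (eR x)) with hP₅
  have iP₁ : Integrable P₁ :=
    (continuous_integrable_of_continuousOn_of_eq_zero hU hK hΘU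
      ((cH'F.mul (cΘ2.continuousOn)).mul cΔF) (fun x hx => by simp [hΘ0 x hx])).2
  have iP₂ : Integrable P₂ :=
    (continuous_integrable_of_continuousOn_of_eq_zero hU hK hΘU
      ((cV.inner cgradF).mul (cH'F.mul cΘ2.continuousOn)) (fun x hx => by simp [hΘ0 x hx])).2
  have iP₃ : Integrable P₃ :=
    (continuous_integrable_of_continuousOn_of_eq_zero hU hK hΘU
      (cinv.mul ((cfderivF.clm_apply ceR).mul (cH'F.mul cΘ2.continuousOn)))
      (fun x hx => by simp [hΘ0 x hx])).2
  have iP₄ : Integrable P₄ :=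
    (continuous_integrable_of_continuousOn_of_eq_zero hU hK hΘU
      (cHF.mul (cV.inner cgradΘ2.continuousOn)) (fun x hx => by
        show H (F x) * ⟪V s x, gradient (fun y => Θ y ^ 2) x⟫ = 0
        rw [hgΘ0 x hx, inner_zero_right, mul_zero])).2
  have iP₅ : Integrable P₅ :=
    (continuous_integrable_of_continuousOn_of_eq_zero hU hK hΘU
      (cinv.mul (cHF.mul (cfderivΘ2.continuousOn.clm_apply ceR))) (fun x hx => by simp [hfΘ0 x hx])).2
  -- (1) the viscous term: Green's identity
  have e₁ : ∫ x, P₁ x = -∫ x, (deriv (deriv H) (F x) * ‖gradient F x‖ ^ 2 * Θ x ^ 2 +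
      deriv H (F x) * ⟪gradient F x, gradient (fun y => Θ y ^ 2) x⟫) :=
    integral_laplacian_mul_deriv_comp_mul_sq_of_contDiffOn hU hF2 hH hΘ hΘc hΘU
  -- the test function `ψ = Θ² H(F)` of the two transport terms
  set ψ : EuclideanSpace ℝ (Fin 3) → ℝ := fun x => Θ x ^ 2 * H (F x) with hψ
  have hψC : ContDiff ℝ 1 ψ :=
    contDiff_cutoff_smul_of_contDiffOn hU hΘ2 (tsupport_mul_subset_right.trans hΘU) (hH1.comp_contDiffOn hF1)
  have hψK : tsupport ψ ⊆ K := tsupport_mul_subset_left.trans tsupport_mul_subset_right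
  have hψc : HasCompactSupport ψ := hK.of_isClosed_subset (isClosed_tsupport _) hψK
  have hψU : tsupport ψ ⊆ U := hψK.trans hΘU
  -- `∇ψ = Θ² H'(F) ∇F + H(F) ∇Θ²` everywhere
  have hgradψ : ∀ x, gradient ψ x =
      (Θ x ^ 2 * deriv H (F x)) • gradient F x + H (F x) • gradient (fun y => Θ y ^ 2) x := by
    intro x
    by_cases hx : x ∈ K
    · have hxU : x ∈ U := hΘU hx
      have hFd : DifferentiableAt ℝ F x := (hF1.differentiableOn one_ne_zero x hxU).differentiableAt (hU.mem_nhds hxU)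
      have hHF : DifferentiableAt ℝ (fun y => H (F y)) x :=
        ((hH.differentiable two_ne_zero) (F x)).comp x hFd
      have hΘ2d : DifferentiableAt ℝ (fun y => Θ y ^ 2) x := (hΘ2.differentiable one_ne_zero) x
      rw [hψ, gradient_mul_apply' hΘ2d hHF,
        gradient_comp_apply ((hH.differentiable two_ne_zero) (F x)) hFd, smul_smul, add_comm]
    · have h0 : gradient ψ x = 0 := gradient_eq_zero_of_notMem_tsupport fun h => hx (hψK h)
      rw [h0, hΘ0 x hx, hgΘ0 x hx]
      simp
  -- (2) the velocity transport term
  have e₂ : ∫ x, P₂ x = -∫ x, P₄ x := by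
    have hz := integral_inner_gradient_eq_zero_of_divergence_eq_zero_of_subset hU hV1 hdivV hψC hψc hψU
    have hsplit : ∫ x, ⟪V s x, gradient ψ x⟫ = (∫ x, P₂ x) + ∫ x, P₄ x := by
      rw [← integral_add iP₂ iP₄]
      refine integral_congr_ae (ae_of_all _ fun x => ?_)
      beta_reduce
      rw [hgradψ x]
      simp only [hP₂, hP₄, inner_add_right, inner_smul_right]
      ring
    rw [hsplit] at hz
    linarith
  -- (3) the drift term, `b = (2/ϱ) e_ϱ`
  have e₃ : ∫ x, P₃ x = -∫ x, P₅ x := by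
    have hb1 : ContDiffOn ℝ 1 (fun y : EuclideanSpace ℝ (Fin 3) => (2 / cylRadius y) • eR y) U :=
      fun x hx => (contDiffAt_axisDrift (hUρ x hx)).contDiffWithinAt
    have hbdiv : ∀ x ∈ U, VectorCalculus.divergence (fun y : EuclideanSpace ℝ (Fin 3) => (2 / cylRadius y) • eR y) x = 0 :=
      fun x hx => divergence_axisDrift_eq_zero (hUρ x hx)
    have hz := integral_inner_gradient_eq_zero_of_divergence_eq_zero_of_subset hU hb1 hbdiv hψC hψc hψU
    have hsplit : ∫ x, ⟪(2 / cylRadius x) • eR x, gradient ψ x⟫ = (∫ x, P₃ x) + ∫ x, P₅ x := by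
      rw [← integral_add iP₃ iP₅]
      refine integral_congr_ae (ae_of_all _ fun x => ?_)
      beta_reduce
      rw [hgradψ x]
      simp only [hP₃, hP₅, inner_add_right, inner_smul_right, inner_axisDrift_gradient]
      ring
    rw [hsplit] at hz
    linarith
  -- the left-hand side is `∫ (P₁ - P₂ - P₃)`
  have eL : ∫ x, deriv H (F x) * ((Δ F) x - fderiv ℝ F x (V s x) -
      2 / cylRadius x * partialDeriv (eR x) F x) * Θ x ^ 2 = ((∫ x, P₁ x) - ∫ x, P₂ x) - ∫ x, P₃ x := by
    calc ∫ x, deriv H (F x) * ((Δ F) x - fderiv ℝ F x (V s x) -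
          2 / cylRadius x * partialDeriv (eR x) F x) * Θ x ^ 2 = ∫ x, ((P₁ x - P₂ x) - P₃ x) := by
          refine integral_congr_ae (ae_of_all _ fun x => ?_)
          beta_reduce
          simp only [hP₁, hP₂, hP₃, partialDeriv_apply]
          rw [real_inner_comm (gradient F x) (V s x), inner_gradient_left]
          ring
      _ = (∫ x, (P₁ x - P₂ x)) - ∫ x, P₃ x := integral_sub (iP₁.sub iP₂) iP₃
      _ = ((∫ x, P₁ x) - ∫ x, P₂ x) - ∫ x, P₃ x := by rw [integral_sub iP₁ iP₂]
  rw [eL, e₁, e₂, e₃]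
  ring

/-! ### Space–time continuity of the swirl gradient and of slice functionals -/

/-- The CLM form of the derivative of the swirl: `DΓ(x) = ⟪Jx, Du(x)·⟫ + ⟪u(x), J·⟫`. [folklore] -/
theorem fderiv_swirl_eq_clm {u : EuclideanSpace ℝ (Fin 3) → EuclideanSpace ℝ (Fin 3)}
    {x : EuclideanSpace ℝ (Fin 3)} (hd : DifferentiableAt ℝ u x) :
    fderiv ℝ (swirl u) x = (innerSL ℝ (rotGen x)).comp (fderiv ℝ u x) + (innerSL ℝ (u x)).comp rotGenL := by
  ext h
  rw [fderiv_swirl_apply hd h]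
  show _ = ((innerSL ℝ (rotGen x)).comp (fderiv ℝ u x)) h + ((innerSL ℝ (u x)).comp rotGenL) h
  simp only [ContinuousLinearMap.comp_apply, innerSL_apply_apply, rotGenL_apply]
  rw [real_inner_comm (u x) (rotGen h)]

/-- `(t, x) ↦ D(σ(t, ·))(x)` is continuous on `S` in space–time for the smooth class. [folklore] -/
theorem continuousOn_fderiv_swirl (hV : IsSmoothAxisymmetricSolutionOn S V P) :
    ContinuousOn (fun z : ℝ × EuclideanSpace ℝ (Fin 3) => fderiv ℝ (swirl (V z.1)) z.2)
      (S : Set (ℝ × EuclideanSpace ℝ (Fin 3))) := by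
  have h1 : ContinuousOn (fun z : ℝ × EuclideanSpace ℝ (Fin 3) =>
      (innerSL ℝ (rotGen z.2)).comp (fderiv ℝ (V z.1) z.2)) (S : Set (ℝ × EuclideanSpace ℝ (Fin 3))) :=
    (((innerSL ℝ).continuous.comp (rotGenL.continuous.comp continuous_snd)).continuousOn).clm_comp
      hV.continuousOn_fderiv
  have h2 : ContinuousOn (fun z : ℝ × EuclideanSpace ℝ (Fin 3) =>
      (innerSL ℝ (V z.1 z.2)).comp rotGenL) (S : Set (ℝ × EuclideanSpace ℝ (Fin 3))) :=
    ((innerSL ℝ).continuous.comp_continuousOn hV.continuousOn_velocity).clm_comp continuousOn_const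
  exact (h1.add h2).congr fun z hz => fderiv_swirl_eq_clm (hV.differentiableAt hz)

/-- `(t, x) ↦ ∇σ(t, ·)(x)` is continuous on `S` in space–time for the smooth class. [folklore] -/
theorem continuousOn_gradient_swirl (hV : IsSmoothAxisymmetricSolutionOn S V P) :
    ContinuousOn (fun z : ℝ × EuclideanSpace ℝ (Fin 3) => gradient (swirl (V z.1)) z.2)
      (S : Set (ℝ × EuclideanSpace ℝ (Fin 3))) :=
  (InnerProductSpace.toDual ℝ (EuclideanSpace ℝ (Fin 3))).symm.continuous.comp_continuousOn
    (continuousOn_fderiv_swirl hV)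

/-- **Continuity in time of slice functionals.** If `Φ` is continuous on `I × U` (`I`, `U` open)
and `Φ(s, x) = 0` whenever `x ∉ K` for a compact `K ⊆ U`, then `s ↦ ∫ Φ(s, x) dx` is continuous
on `I` (Mathlib's `continuousOn_integral_of_compact_support`; near points `(s, x)` with `x ∉ U`
the integrand vanishes identically). [folklore] -/
theorem continuousOn_integral_slice_of_eq_zero {Φ : ℝ × EuclideanSpace ℝ (Fin 3) → ℝ} {I : Set ℝ}
    {W K : Set (EuclideanSpace ℝ (Fin 3))} (hW : IsOpen W) (hK : IsCompact K)
    (hKW : K ⊆ W) (hΦ : ContinuousOn Φ (I ×ˢ W)) (h0 : ∀ s x, x ∉ K → Φ (s, x) = 0) :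
    ContinuousOn (fun s => ∫ x, Φ (s, x)) I := by
  refine continuousOn_integral_of_compact_support (f := fun s x => Φ (s, x)) hK ?_
    (fun s x _ hx => h0 s x hx)
  intro p hp
  rw [mem_prod] at hp
  by_cases hx : p.2 ∈ W
  · have hpW : p ∈ I ×ˢ W := ⟨hp.1, hx⟩
    have hmem : I ×ˢ W ∈ 𝓝[I ×ˢ (univ : Set (EuclideanSpace ℝ (Fin 3)))] p := by
      have h1 : I ×ˢ W ∈ 𝓝[I ×ˢ W] p := self_mem_nhdsWithin
      have h2 : (univ : Set ℝ) ×ˢ W ∈ 𝓝 p := (isOpen_univ.prod hW).mem_nhds ⟨trivial, hx⟩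
      have h3 : I ×ˢ W = (I ×ˢ (univ : Set (EuclideanSpace ℝ (Fin 3)))) ∩ ((univ : Set ℝ) ×ˢ W) := by
        ext q; simp [mem_prod]
      rw [h3]
      exact inter_mem_nhdsWithin _ h2
    exact ((hΦ p hpW).mono_of_mem_nhdsWithin hmem).congr (fun q _ => rfl) rfl
  · have hxK : p.2 ∉ K := fun h => hx (hKW h)
    have hev : (uncurry fun s x => Φ (s, x)) =ᶠ[𝓝 p] fun _ => 0 := by
      have ho : IsOpen ((univ : Set ℝ) ×ˢ Kᶜ) := isOpen_univ.prod hK.isClosed.isOpen_compl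
      filter_upwards [ho.mem_nhds ⟨trivial, hxK⟩] with q hq
      exact h0 q.1 q.2 hq.2
    exact (continuousAt_const.congr hev.symm).continuousWithinAt

/-- **The energy identity for the swirl off the axis, integrated in time** (Seregin 2020, proof of
Thm. 2.1, arXiv pp. 4–5; Lei–Zhang 2011, (2.2)–(2.3)). For the class
`IsSmoothAxisymmetricSolutionOn S`, `S = ]lo, hi[ × U` rotation invariant with `U` open and off
the axis, `H ∈ C²`, a cut-off `Θ ∈ C¹_c` with `tsupport Θ ⊆ U`, a time factor `η ∈ C¹` and
`lo < t₁ ≤ t₂ < hi`: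
`∫ (H(σ(t₂))η(t₂) - H(σ(t₁))η(t₁)) Θ² = ∫_{t₁}^{t₂} (η [-∫(H''(σ)|∇σ|²Θ² + H'(σ)⟪∇σ,∇Θ²⟫) + ∫H(σ)⟪V,∇Θ²⟫ + ∫(2/ϱ)H(σ)∂_ϱΘ²] + η' ∫H(σ)Θ²) ds`
(the swirl equation (2.2) with its classical time derivative off the axis,
`swirl_sub_eq_intervalIntegral_offAxis`, the integrated chain rule in time, and the slice
identity). [cite: Seregin2020, proof of Thm. 2.1 (arXiv pp. 4–5), the energy identity] -/
theorem swirl_energy_identity (hU : IsOpen U)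
    (hSU : (S : Set (ℝ × EuclideanSpace ℝ (Fin 3))) = Ioo lo hi ×ˢ U)
    (hS : ∀ θ : ℝ, ∀ z ∈ (S : Set (ℝ × EuclideanSpace ℝ (Fin 3))), stRot θ z ∈ (S : Set (ℝ × EuclideanSpace ℝ (Fin 3))))
    (hUρ : ∀ x ∈ U, cylRadius x ≠ 0) (hV : IsSmoothAxisymmetricSolutionOn S V P)
    {H : ℝ → ℝ} (hH : ContDiff ℝ 2 H)
    {Θ : EuclideanSpace ℝ (Fin 3) → ℝ} (hΘ : ContDiff ℝ 1 Θ) (hΘc : HasCompactSupport Θ)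
    (hΘU : tsupport Θ ⊆ U) {η : ℝ → ℝ} (hη : ContDiff ℝ 1 η)
    {t₁ t₂ : ℝ} (h1 : lo < t₁) (h12 : t₁ ≤ t₂) (h2 : t₂ < hi) :
    ∫ x, (H (swirl (V t₂) x) * η t₂ - H (swirl (V t₁) x) * η t₁) * Θ x ^ 2 =
      ∫ s in t₁..t₂, (η s *
        (-(∫ x, (deriv (deriv H) (swirl (V s) x) * ‖gradient (swirl (V s)) x‖ ^ 2 * Θ x ^ 2 +
            deriv H (swirl (V s) x) * ⟪gradient (swirl (V s)) x, gradient (fun y => Θ y ^ 2) x⟫)) +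
          (∫ x, H (swirl (V s) x) * ⟪V s x, gradient (fun y => Θ y ^ 2) x⟫) +
          ∫ x, 2 / cylRadius x * (H (swirl (V s) x) * fderiv ℝ (fun y => Θ y ^ 2) x (eR x))) +
        deriv η s * ∫ x, H (swirl (V s) x) * Θ x ^ 2) := by
  -- notation: the swirl operator as an opaque space–time function
  obtain ⟨G, hG⟩ : ∃ G : ℝ → EuclideanSpace ℝ (Fin 3) → ℝ, ∀ r x, G r x =
      (Δ (swirl (V r))) x - fderiv ℝ (swirl (V r)) x (V r x) -
        2 / cylRadius x * partialDeriv (eR x) (swirl (V r)) x := ⟨_, fun _ _ => rfl⟩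
  set K : Set (EuclideanSpace ℝ (Fin 3)) := tsupport Θ with hKdef
  have hK : IsCompact K := hΘc
  have hKm : MeasurableSet K := hK.isClosed.measurableSet
  have hρS : ∀ z ∈ (S : Set (ℝ × EuclideanSpace ℝ (Fin 3))), cylRadius z.2 ≠ 0 := by
    intro z hz
    rw [hSU] at hz
    exact hUρ z.2 hz.2
  have hIcc : Icc t₁ t₂ ⊆ Ioo lo hi := fun r hr => ⟨lt_of_lt_of_le h1 hr.1, lt_of_le_of_lt hr.2 h2⟩
  have hΘ0 : ∀ x, x ∉ K → Θ x = 0 := fun x hx => image_eq_zero_of_notMem_tsupport hx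
  have hH1 : ContDiff ℝ 1 H := hH.of_le one_le_two
  have hH' : ContDiff ℝ 1 (deriv H) := by
    have h2' : ContDiff ℝ (1 + 1) H := by rw [one_add_one_eq_two]; exact hH
    exact h2'.deriv'
  -- space–time continuity on `S`
  have cσ : ContinuousOn (fun z : ℝ × EuclideanSpace ℝ (Fin 3) => swirl (V z.1) z.2)
      (S : Set (ℝ × EuclideanSpace ℝ (Fin 3))) := hV.continuousOn_swirl
  have cG : ContinuousOn (fun z : ℝ × EuclideanSpace ℝ (Fin 3) => G z.1 z.2) (S : Set (ℝ × EuclideanSpace ℝ (Fin 3))) :=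
    (continuousOn_swirlOperator_offAxis hV hρS).congr fun z _ => hG z.1 z.2
  -- (1) the time-integrated equation, for every `x ∈ K`
  have hgn : ∀ᵐ x ∂(volume.restrict K), IntervalIntegrable (fun r => G r x) volume t₁ t₂ ∧
      ∀ s ∈ Icc t₁ t₂, swirl (V s) x = swirl (V t₁) x + ∫ r in t₁..s, G r x := by
    rw [ae_restrict_iff' hKm]
    refine ae_of_all _ fun x hx => ?_
    have hxU : x ∈ U := hΘU hx
    have hmk : Continuous fun r : ℝ => ((r, x) : ℝ × EuclideanSpace ℝ (Fin 3)) := continuous_id.prodMk continuous_const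
    have hGc : ContinuousOn (fun r => G r x) (Ioo lo hi) := by
      refine ContinuousOn.comp (g := fun z : ℝ × EuclideanSpace ℝ (Fin 3) => G z.1 z.2)
        (f := fun r : ℝ => ((r, x) : ℝ × EuclideanSpace ℝ (Fin 3))) cG hmk.continuousOn fun r hr => ?_
      show ((r, x) : ℝ × EuclideanSpace ℝ (Fin 3)) ∈ (S : Set (ℝ × EuclideanSpace ℝ (Fin 3)))
      rw [hSU]
      exact ⟨hr, hxU⟩
    have hsub : uIcc t₁ t₂ ⊆ Ioo lo hi := by
      rw [uIcc_of_le h12]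
      exact hIcc
    refine ⟨(hGc.mono hsub).intervalIntegrable, fun s hs => ?_⟩
    have h := swirl_sub_eq_intervalIntegral_offAxis hU hSU hS hρS hV hxU h1 hs.1 (lt_of_le_of_lt hs.2 h2)
    have e : ∫ r in t₁..s, G r x = ∫ r in t₁..s, ((Δ (swirl (V r))) x - fderiv ℝ (swirl (V r)) x (V r x) -
        2 / cylRadius x * partialDeriv (eR x) (swirl (V r)) x) :=
      intervalIntegral.integral_congr fun r _ => hG r x
    rw [e, ← h]
    ring
  -- (2) integrability of the space–time integrand on `(t₁, t₂] × K`
  have cΦ : ContinuousOn (fun p : ℝ × EuclideanSpace ℝ (Fin 3) =>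
      (deriv H (swirl (V p.1) p.2) * G p.1 p.2 * η p.1 + H (swirl (V p.1) p.2) * deriv η p.1) * Θ p.2 ^ 2)
      (S : Set (ℝ × EuclideanSpace ℝ (Fin 3))) := by
    have c1 : ContinuousOn (fun z : ℝ × EuclideanSpace ℝ (Fin 3) => deriv H (swirl (V z.1) z.2))
        (S : Set (ℝ × EuclideanSpace ℝ (Fin 3))) := hH'.continuous.comp_continuousOn cσ
    have c2 : ContinuousOn (fun z : ℝ × EuclideanSpace ℝ (Fin 3) => H (swirl (V z.1) z.2))
        (S : Set (ℝ × EuclideanSpace ℝ (Fin 3))) := hH.continuous.comp_continuousOn cσ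
    have c3 : Continuous fun z : ℝ × EuclideanSpace ℝ (Fin 3) => η z.1 := hη.continuous.comp continuous_fst
    have c4 : Continuous fun z : ℝ × EuclideanSpace ℝ (Fin 3) => deriv η z.1 :=
      (hη.continuous_deriv le_rfl).comp continuous_fst
    have c5 : Continuous fun z : ℝ × EuclideanSpace ℝ (Fin 3) => Θ z.2 ^ 2 :=
      (hΘ.continuous.comp continuous_snd).pow 2
    exact (((c1.mul cG).mul c3.continuousOn).add (c2.mul c4.continuousOn)).mul c5.continuousOn
  have hint : Integrable (fun p : ℝ × EuclideanSpace ℝ (Fin 3) =>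
      (deriv H (swirl (V p.1) p.2) * G p.1 p.2 * η p.1 + H (swirl (V p.1) p.2) * deriv η p.1) * Θ p.2 ^ 2)
      ((volume.restrict (Ioc t₁ t₂)).prod (volume.restrict K)) := by
    have hsub : Icc t₁ t₂ ×ˢ K ⊆ (S : Set (ℝ × EuclideanSpace ℝ (Fin 3))) := by
      rw [hSU]
      exact prod_mono hIcc hΘU
    have hcpt : IsCompact (Icc t₁ t₂ ×ˢ K) := isCompact_Icc.prod hK
    have hI := (cΦ.mono hsub).integrableOn_compact hcpt
      (μ := ((volume : Measure ℝ).prod (volume : Measure (EuclideanSpace ℝ (Fin 3)))))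
    have hI' := hI.mono_set (prod_mono Ioc_subset_Icc_self Subset.rfl)
    rw [IntegrableOn, ← Measure.prod_restrict] at hI'
    exact hI'
  -- (3) the integrated chain rule
  have hchain := integral_comp_mul_sub_eq_integral_integral_ae (μ := volume.restrict K)
    (g := fun r x => swirl (V r) x) (n := G) h12 hgn hH1 hη (fun x => Θ x ^ 2) hint
  -- (4) remove the restriction to `K` (the integrands vanish off `K`)
  have eLHS : ∫ x in K, (H (swirl (V t₂) x) * η t₂ - H (swirl (V t₁) x) * η t₁) * Θ x ^ 2 =
      ∫ x, (H (swirl (V t₂) x) * η t₂ - H (swirl (V t₁) x) * η t₁) * Θ x ^ 2 :=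
    setIntegral_eq_integral_of_forall_compl_eq_zero fun x hx => by simp [hΘ0 x hx]
  have eRHS : ∀ s, ∫ x in K, (deriv H (swirl (V s) x) * G s x * η s + H (swirl (V s) x) * deriv η s) * Θ x ^ 2 =
      ∫ x, (deriv H (swirl (V s) x) * G s x * η s + H (swirl (V s) x) * deriv η s) * Θ x ^ 2 := fun s =>
    setIntegral_eq_integral_of_forall_compl_eq_zero fun x hx => by simp [hΘ0 x hx]
  rw [eLHS] at hchain
  simp_rw [eRHS] at hchain
  rw [hchain]
  -- (5) the slice identity, for `s ∈ [t₁, t₂]`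
  refine intervalIntegral.integral_congr fun s hs => ?_
  rw [uIcc_of_le h12] at hs
  have hsI : s ∈ Ioo lo hi := hIcc hs
  have hF2 : ContDiffOn ℝ 2 (swirl (V s)) U := contDiffOn_swirl_slice hSU hV hsI
  have cF : ContinuousOn (swirl (V s)) U := hF2.continuousOn
  have hmk : Continuous fun x : EuclideanSpace ℝ (Fin 3) => ((s, x) : ℝ × EuclideanSpace ℝ (Fin 3)) :=
    continuous_const.prodMk continuous_id
  have cGs : ContinuousOn (fun x => G s x) U := by
    refine ContinuousOn.comp (g := fun z : ℝ × EuclideanSpace ℝ (Fin 3) => G z.1 z.2)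
      (f := fun x : EuclideanSpace ℝ (Fin 3) => ((s, x) : ℝ × EuclideanSpace ℝ (Fin 3))) cG hmk.continuousOn fun x hx => ?_
    show ((s, x) : ℝ × EuclideanSpace ℝ (Fin 3)) ∈ (S : Set (ℝ × EuclideanSpace ℝ (Fin 3)))
    rw [hSU]
    exact ⟨hsI, hx⟩
  have cΘ2 : Continuous fun y : EuclideanSpace ℝ (Fin 3) => Θ y ^ 2 := hΘ.continuous.pow 2
  have iA : Integrable fun x => deriv H (swirl (V s) x) * G s x * Θ x ^ 2 :=
    (continuous_integrable_of_continuousOn_of_eq_zero hU hK hΘU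
      (((hH'.continuous.comp_continuousOn cF).mul cGs).mul cΘ2.continuousOn) (fun x hx => by simp [hΘ0 x hx])).2
  have iB : Integrable fun x => H (swirl (V s) x) * Θ x ^ 2 :=
    (continuous_integrable_of_continuousOn_of_eq_zero hU hK hΘU
      ((hH.continuous.comp_continuousOn cF).mul cΘ2.continuousOn) (fun x hx => by simp [hΘ0 x hx])).2
  have hsplit : ∫ x, (deriv H (swirl (V s) x) * G s x * η s + H (swirl (V s) x) * deriv η s) * Θ x ^ 2 =
      η s * (∫ x, deriv H (swirl (V s) x) * G s x * Θ x ^ 2) + deriv η s * ∫ x, H (swirl (V s) x) * Θ x ^ 2 := by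
    rw [← MeasureTheory.integral_const_mul, ← MeasureTheory.integral_const_mul,
      ← integral_add (iA.const_mul _) (iB.const_mul _)]
    refine integral_congr_ae (ae_of_all _ fun x => ?_)
    beta_reduce
    ring
  rw [hsplit]
  have eA : ∫ x, deriv H (swirl (V s) x) * G s x * Θ x ^ 2 =
      ∫ x, deriv H (swirl (V s) x) * ((Δ (swirl (V s))) x - fderiv ℝ (swirl (V s)) x (V s x) -
        2 / cylRadius x * partialDeriv (eR x) (swirl (V s)) x) * Θ x ^ 2 :=
    integral_congr_ae (ae_of_all _ fun x => by beta_reduce; rw [hG s x])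
  rw [eA, swirl_energy_slice_identity hU hSU hUρ hV hH hΘ hΘc hΘU hsI]

/-! ### The energy inequality (absorbing the viscous cross term) -/

/-- **The pointwise inequality behind the absorption of the cross term** (Lei–Zhang 2011, (2.4),
with `κ = 2`): if `h'² ≤ 2 h h''` with `h, h'' ≥ 0`, then for `a, c ≥ 0`,
`2|h'| a c ≤ h'' a²/2 + 4 h c²` (AM–GM: `(X + Y)² - (2|h'|ac)² = (X - Y)² + 4(XY - h'²a²c²) ≥ 0`
with `X = h''a²/2`, `Y = 4hc²`, `XY = 2hh''a²c²`). [cite: LeiZhang2011, §2 (2.4) (arXiv p. 7)] -/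
theorem kappa_two_mul_abs_le {h h' h'' a c : ℝ} (hh : 0 ≤ h) (hh'' : 0 ≤ h'') (hκ : h' ^ 2 ≤ 2 * h * h'')
    (ha : 0 ≤ a) (hc : 0 ≤ c) : 2 * |h'| * a * c ≤ h'' * a ^ 2 / 2 + 4 * (h * c ^ 2) := by
  have hu : 0 ≤ |h'| := abs_nonneg _
  have hu2 : |h'| ^ 2 ≤ 2 * h * h'' := by rw [sq_abs]; exact hκ
  have hX : 0 ≤ h'' * a ^ 2 / 2 := by positivity
  have hY : 0 ≤ 4 * (h * c ^ 2) := by positivity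
  have hL : 0 ≤ 2 * |h'| * a * c := by positivity
  have hprod : (|h'| * a * c) ^ 2 ≤ (h'' * a ^ 2 / 2) * (4 * (h * c ^ 2)) := by
    have h1 : (|h'| * a * c) ^ 2 = |h'| ^ 2 * (a ^ 2 * c ^ 2) := by ring
    have h2 : (h'' * a ^ 2 / 2) * (4 * (h * c ^ 2)) = (2 * h * h'') * (a ^ 2 * c ^ 2) := by ring
    rw [h1, h2]
    exact mul_le_mul_of_nonneg_right hu2 (by positivity)
  have key : (2 * |h'| * a * c) ^ 2 ≤ (h'' * a ^ 2 / 2 + 4 * (h * c ^ 2)) ^ 2 := by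
    nlinarith [sq_nonneg (h'' * a ^ 2 / 2 - 4 * (h * c ^ 2)), hprod]
  exact (pow_le_pow_iff_left₀ hL (add_nonneg hX hY) two_ne_zero).1 key

/-- `∇(Θ²) = 2Θ ∇Θ` for `Θ ∈ C¹`. [folklore] -/
theorem gradient_sq_apply {Θ : EuclideanSpace ℝ (Fin 3) → ℝ} (hΘ : ContDiff ℝ 1 Θ) (x : EuclideanSpace ℝ (Fin 3)) :
    gradient (fun y => Θ y ^ 2) x = (2 * Θ x) • gradient Θ x := by
  have hd : DifferentiableAt ℝ Θ x := (hΘ.differentiable one_ne_zero) x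
  have h := gradient_comp_apply (H := fun t : ℝ => t ^ 2) (F := Θ) (x := x)
    ((differentiable_pow 2) (Θ x)) hd
  rw [h]
  congr 1
  simp

/-- **The cross term is absorbed pointwise**: with `H'² ≤ 2HH''`, `H, H'' ≥ 0`,
`-H'(F)⟪∇F, ∇(Θ²)⟫ ≤ ½ H''(F)‖∇F‖²Θ² + 4 H(F)‖∇Θ‖²`. [cite: LeiZhang2011, §2 (2.4) (arXiv p. 7)] -/
theorem neg_cross_le_pointwise {H : ℝ → ℝ} (hH0 : ∀ v, 0 ≤ H v) (hH2 : ∀ v, 0 ≤ deriv (deriv H) v)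
    (hκ : ∀ v, deriv H v ^ 2 ≤ 2 * H v * deriv (deriv H) v)
    {Θ : EuclideanSpace ℝ (Fin 3) → ℝ} (hΘ : ContDiff ℝ 1 Θ) (F : EuclideanSpace ℝ (Fin 3) → ℝ)
    (x : EuclideanSpace ℝ (Fin 3)) :
    -(deriv H (F x) * ⟪gradient F x, gradient (fun y => Θ y ^ 2) x⟫) ≤
      deriv (deriv H) (F x) * ‖gradient F x‖ ^ 2 * Θ x ^ 2 / 2 + 4 * (H (F x) * ‖gradient Θ x‖ ^ 2) := by
  rw [gradient_sq_apply hΘ x, inner_smul_right]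
  have hcs : |⟪gradient F x, gradient Θ x⟫| ≤ ‖gradient F x‖ * ‖gradient Θ x‖ := abs_real_inner_le_norm _ _
  have h1 : -(deriv H (F x) * (2 * Θ x * ⟪gradient F x, gradient Θ x⟫)) ≤
      2 * |deriv H (F x)| * (‖gradient F x‖ * |Θ x|) * ‖gradient Θ x‖ := by
    have e : -(deriv H (F x) * (2 * Θ x * ⟪gradient F x, gradient Θ x⟫)) =
        2 * (-(deriv H (F x) * Θ x * ⟪gradient F x, gradient Θ x⟫)) := by ring
    rw [e]
    have h2 : -(deriv H (F x) * Θ x * ⟪gradient F x, gradient Θ x⟫) ≤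
        |deriv H (F x) * Θ x * ⟪gradient F x, gradient Θ x⟫| := neg_le_abs _
    have h3 : |deriv H (F x) * Θ x * ⟪gradient F x, gradient Θ x⟫| ≤
        |deriv H (F x)| * |Θ x| * (‖gradient F x‖ * ‖gradient Θ x‖) := by
      rw [abs_mul, abs_mul]
      exact mul_le_mul_of_nonneg_left hcs (by positivity)
    nlinarith [h2, h3, abs_nonneg (deriv H (F x)), abs_nonneg (Θ x), norm_nonneg (gradient F x),
      norm_nonneg (gradient Θ x)]
  have h4 := kappa_two_mul_abs_le (hH0 (F x)) (hH2 (F x)) (hκ (F x))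
    (mul_nonneg (norm_nonneg (gradient F x)) (abs_nonneg (Θ x))) (norm_nonneg (gradient Θ x))
  have e2 : (‖gradient F x‖ * |Θ x|) ^ 2 = ‖gradient F x‖ ^ 2 * Θ x ^ 2 := by
    rw [mul_pow, sq_abs]
  rw [e2] at h4
  calc -(deriv H (F x) * (2 * Θ x * ⟪gradient F x, gradient Θ x⟫))
      ≤ 2 * |deriv H (F x)| * (‖gradient F x‖ * |Θ x|) * ‖gradient Θ x‖ := h1
    _ ≤ deriv (deriv H) (F x) * (‖gradient F x‖ ^ 2 * Θ x ^ 2) / 2 + 4 * (H (F x) * ‖gradient Θ x‖ ^ 2) := h4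
    _ = _ := by ring

/-- **Continuity in time of the six slice functionals of the energy method** (`M = ∫H(σ)Θ²`,
`G_H = ∫H''(σ)|∇σ|²Θ²`, `T₁ = ∫H'(σ)⟪∇σ,∇Θ²⟫`, `P = ∫H(σ)|∇Θ|²`, `T_V = ∫H(σ)⟪V,∇Θ²⟫`,
`T_b = ∫(2/ϱ)H(σ)∂_ϱΘ²`) on `]lo, hi[`, for the class on `S = ]lo, hi[ × U`, `U` off the axis,
`H ∈ C²`, `Θ ∈ C¹_c`, `tsupport Θ ⊆ U`. [folklore] -/
theorem continuousOn_swirl_sliceFunctionals (hU : IsOpen U)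
    (hSU : (S : Set (ℝ × EuclideanSpace ℝ (Fin 3))) = Ioo lo hi ×ˢ U)
    (hUρ : ∀ x ∈ U, cylRadius x ≠ 0) (hV : IsSmoothAxisymmetricSolutionOn S V P)
    {H : ℝ → ℝ} (hH : ContDiff ℝ 2 H)
    {Θ : EuclideanSpace ℝ (Fin 3) → ℝ} (hΘ : ContDiff ℝ 1 Θ) (hΘc : HasCompactSupport Θ)
    (hΘU : tsupport Θ ⊆ U) {M GH T₁ Pf TV Tb : ℝ → ℝ}
    (hM : ∀ s, M s = ∫ x, H (swirl (V s) x) * Θ x ^ 2)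
    (hGH : ∀ s, GH s = ∫ x, deriv (deriv H) (swirl (V s) x) * ‖gradient (swirl (V s)) x‖ ^ 2 * Θ x ^ 2)
    (hT₁ : ∀ s, T₁ s = ∫ x, deriv H (swirl (V s) x) * ⟪gradient (swirl (V s)) x, gradient (fun y => Θ y ^ 2) x⟫)
    (hPf : ∀ s, Pf s = ∫ x, H (swirl (V s) x) * ‖gradient Θ x‖ ^ 2)
    (hTV : ∀ s, TV s = ∫ x, H (swirl (V s) x) * ⟪V s x, gradient (fun y => Θ y ^ 2) x⟫)
    (hTb : ∀ s, Tb s = ∫ x, 2 / cylRadius x * (H (swirl (V s) x) * fderiv ℝ (fun y => Θ y ^ 2) x (eR x))) :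
    ContinuousOn M (Ioo lo hi) ∧ ContinuousOn GH (Ioo lo hi) ∧ ContinuousOn T₁ (Ioo lo hi) ∧
      ContinuousOn Pf (Ioo lo hi) ∧ ContinuousOn TV (Ioo lo hi) ∧ ContinuousOn Tb (Ioo lo hi) := by
  set K : Set (EuclideanSpace ℝ (Fin 3)) := tsupport Θ with hKdef
  have hK : IsCompact K := hΘc
  have hΘ0 : ∀ x, x ∉ K → Θ x = 0 := fun x hx => image_eq_zero_of_notMem_tsupport hx
  have hgΘ0 : ∀ x, x ∉ K → gradient (fun y => Θ y ^ 2) x = 0 := fun x hx => gradient_sq_eq_zero_of_notMem hx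
  have hfΘ0 : ∀ x, x ∉ K → fderiv ℝ (fun y => Θ y ^ 2) x = 0 := fun x hx => fderiv_sq_eq_zero_of_notMem hx
  have hgΘ0' : ∀ x, x ∉ K → gradient Θ x = 0 := fun x hx => gradient_eq_zero_of_notMem_tsupport hx
  have hρS : ∀ z ∈ (S : Set (ℝ × EuclideanSpace ℝ (Fin 3))), cylRadius z.2 ≠ 0 := by
    intro z hz
    rw [hSU] at hz
    exact hUρ z.2 hz.2
  have hH' : ContDiff ℝ 1 (deriv H) := by
    have h2' : ContDiff ℝ (1 + 1) H := by rw [one_add_one_eq_two]; exact hH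
    exact h2'.deriv'
  have hΘ2 : ContDiff ℝ 1 fun y => Θ y ^ 2 := hΘ.pow 2
  -- continuity on `S` of the building blocks (as space–time functions)
  have cσ : ContinuousOn (fun z : ℝ × EuclideanSpace ℝ (Fin 3) => swirl (V z.1) z.2)
      (S : Set (ℝ × EuclideanSpace ℝ (Fin 3))) := hV.continuousOn_swirl
  have cHσ : ContinuousOn (fun z : ℝ × EuclideanSpace ℝ (Fin 3) => H (swirl (V z.1) z.2))
      (S : Set (ℝ × EuclideanSpace ℝ (Fin 3))) := hH.continuous.comp_continuousOn cσ
  have cH'σ : ContinuousOn (fun z : ℝ × EuclideanSpace ℝ (Fin 3) => deriv H (swirl (V z.1) z.2))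
      (S : Set (ℝ × EuclideanSpace ℝ (Fin 3))) := hH'.continuous.comp_continuousOn cσ
  have cH''σ : ContinuousOn (fun z : ℝ × EuclideanSpace ℝ (Fin 3) => deriv (deriv H) (swirl (V z.1) z.2))
      (S : Set (ℝ × EuclideanSpace ℝ (Fin 3))) := (hH'.continuous_deriv le_rfl).comp_continuousOn cσ
  have cgσ := continuousOn_gradient_swirl hV
  have cV := hV.continuousOn_velocity
  have cΘ2 : Continuous fun z : ℝ × EuclideanSpace ℝ (Fin 3) => Θ z.2 ^ 2 := (hΘ.continuous.comp continuous_snd).pow 2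
  have cgΘ : Continuous fun z : ℝ × EuclideanSpace ℝ (Fin 3) => gradient Θ z.2 :=
    (continuous_gradient_of_contDiff hΘ).comp continuous_snd
  have cgΘ2 : Continuous fun z : ℝ × EuclideanSpace ℝ (Fin 3) => gradient (fun y => Θ y ^ 2) z.2 :=
    (continuous_gradient_of_contDiff hΘ2).comp continuous_snd
  have cfΘ2 : Continuous fun z : ℝ × EuclideanSpace ℝ (Fin 3) => fderiv ℝ (fun y => Θ y ^ 2) z.2 :=
    (hΘ2.continuous_fderiv one_ne_zero).comp continuous_snd
  have ceR : ContinuousOn (fun z : ℝ × EuclideanSpace ℝ (Fin 3) => eR z.2) (S : Set (ℝ × EuclideanSpace ℝ (Fin 3))) :=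
    continuousOn_eR_offAxis.comp continuous_snd.continuousOn fun z hz => hρS z hz
  have cinv : ContinuousOn (fun z : ℝ × EuclideanSpace ℝ (Fin 3) => 2 / cylRadius z.2) (S : Set (ℝ × EuclideanSpace ℝ (Fin 3))) :=
    continuousOn_const.div (continuous_cylRadius.comp continuous_snd).continuousOn hρS
  have hSU' : (S : Set (ℝ × EuclideanSpace ℝ (Fin 3))) = Ioo lo hi ×ˢ U := hSU
  -- the six functionals
  refine ⟨?_, ?_, ?_, ?_, ?_, ?_⟩
  · have h := continuousOn_integral_slice_of_eq_zero (I := Ioo lo hi) hU hK hΘU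
      (Φ := fun z : ℝ × EuclideanSpace ℝ (Fin 3) => H (swirl (V z.1) z.2) * Θ z.2 ^ 2)
      (by rw [← hSU']; exact cHσ.mul cΘ2.continuousOn) (fun s x hx => by simp [hΘ0 x hx])
    exact h.congr fun s _ => hM s
  · have h := continuousOn_integral_slice_of_eq_zero (I := Ioo lo hi) hU hK hΘU
      (Φ := fun z : ℝ × EuclideanSpace ℝ (Fin 3) =>
        deriv (deriv H) (swirl (V z.1) z.2) * ‖gradient (swirl (V z.1)) z.2‖ ^ 2 * Θ z.2 ^ 2)
      (by rw [← hSU']; exact (cH''σ.mul (cgσ.norm.pow 2)).mul cΘ2.continuousOn) (fun s x hx => by simp [hΘ0 x hx])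
    exact h.congr fun s _ => hGH s
  · have h := continuousOn_integral_slice_of_eq_zero (I := Ioo lo hi) hU hK hΘU
      (Φ := fun z : ℝ × EuclideanSpace ℝ (Fin 3) =>
        deriv H (swirl (V z.1) z.2) * ⟪gradient (swirl (V z.1)) z.2, gradient (fun y => Θ y ^ 2) z.2⟫)
      (by rw [← hSU']; exact cH'σ.mul (cgσ.inner cgΘ2.continuousOn)) (fun s x hx => by
        show deriv H (swirl (V s) x) * ⟪gradient (swirl (V s)) x, gradient (fun y => Θ y ^ 2) x⟫ = 0
        rw [hgΘ0 x hx, inner_zero_right, mul_zero])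
    exact h.congr fun s _ => hT₁ s
  · have h := continuousOn_integral_slice_of_eq_zero (I := Ioo lo hi) hU hK hΘU
      (Φ := fun z : ℝ × EuclideanSpace ℝ (Fin 3) => H (swirl (V z.1) z.2) * ‖gradient Θ z.2‖ ^ 2)
      (by rw [← hSU']; exact cHσ.mul (cgΘ.norm.pow 2).continuousOn) (fun s x hx => by simp [hgΘ0' x hx])
    exact h.congr fun s _ => hPf s
  · have h := continuousOn_integral_slice_of_eq_zero (I := Ioo lo hi) hU hK hΘU
      (Φ := fun z : ℝ × EuclideanSpace ℝ (Fin 3) => H (swirl (V z.1) z.2) * ⟪V z.1 z.2, gradient (fun y => Θ y ^ 2) z.2⟫)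
      (by rw [← hSU']; exact cHσ.mul (cV.inner cgΘ2.continuousOn)) (fun s x hx => by
        show H (swirl (V s) x) * ⟪V s x, gradient (fun y => Θ y ^ 2) x⟫ = 0
        rw [hgΘ0 x hx, inner_zero_right, mul_zero])
    exact h.congr fun s _ => hTV s
  · have h := continuousOn_integral_slice_of_eq_zero (I := Ioo lo hi) hU hK hΘU
      (Φ := fun z : ℝ × EuclideanSpace ℝ (Fin 3) =>
        2 / cylRadius z.2 * (H (swirl (V z.1) z.2) * fderiv ℝ (fun y => Θ y ^ 2) z.2 (eR z.2)))
      (by rw [← hSU']; exact cinv.mul (cHσ.mul (cfΘ2.continuousOn.clm_apply ceR))) (fun s x hx => by simp [hfΘ0 x hx])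
    exact h.congr fun s _ => hTb s

/-- **Seregin's energy inequality for the swirl, off the axis** (Seregin 2020, proof of Thm. 2.1,
arXiv p. 5: "Combining previous relationships, we find the following energy inequality"; in the
convex-function form of Lei–Zhang 2011, (2.4), with the viscous cross term absorbed by
`H'² ≤ 2HH''`). For the class `IsSmoothAxisymmetricSolutionOn S`, `S = ]lo, hi[ × U` rotation
invariant with `U` open and off the axis; `H ∈ C²` with `H, H'' ≥ 0`, `H'² ≤ 2HH''`; a cut-off
`Θ ∈ C¹_c` with `tsupport Θ ⊆ U`; a time factor `η ∈ C¹`, `η ≥ 0`, `η(t₁) = 0`; and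
`lo < t₁ ≤ t < hi`:
`η(t) M(t) + ½ ∫_{t₁}^t η G_H ≤ ∫_{t₁}^t (4 η P + η T_V + η T_b + |η'| M) ds`,
where `M = ∫H(σ)Θ²`, `G_H = ∫H''(σ)|∇σ|²Θ²`, `P = ∫H(σ)|∇Θ|²`, `T_V = ∫H(σ)⟪V, ∇Θ²⟫` and
`T_b = ∫(2/ϱ)H(σ)∂_ϱ(Θ²)` (`σ = swirl (V s)`; the last two are the transport terms of the paper,
moved onto the cut-off, before any estimate).
[cite: Seregin2020, proof of Thm. 2.1 (arXiv p. 5), the energy inequality] -/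
theorem swirl_energy_inequality (hU : IsOpen U)
    (hSU : (S : Set (ℝ × EuclideanSpace ℝ (Fin 3))) = Ioo lo hi ×ˢ U)
    (hS : ∀ θ : ℝ, ∀ z ∈ (S : Set (ℝ × EuclideanSpace ℝ (Fin 3))), stRot θ z ∈ (S : Set (ℝ × EuclideanSpace ℝ (Fin 3))))
    (hUρ : ∀ x ∈ U, cylRadius x ≠ 0) (hV : IsSmoothAxisymmetricSolutionOn S V P)
    {H : ℝ → ℝ} (hH : ContDiff ℝ 2 H) (hH0 : ∀ v, 0 ≤ H v) (hH2 : ∀ v, 0 ≤ deriv (deriv H) v)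
    (hκ : ∀ v, deriv H v ^ 2 ≤ 2 * H v * deriv (deriv H) v)
    {Θ : EuclideanSpace ℝ (Fin 3) → ℝ} (hΘ : ContDiff ℝ 1 Θ) (hΘc : HasCompactSupport Θ)
    (hΘU : tsupport Θ ⊆ U) {η : ℝ → ℝ} (hη : ContDiff ℝ 1 η) (hη0 : ∀ s, 0 ≤ η s)
    {t₁ t : ℝ} (h1 : lo < t₁) (h1t : t₁ ≤ t) (ht : t < hi) (hη1 : η t₁ = 0)
    {M GH Pf TV Tb : ℝ → ℝ}
    (hM : ∀ s, M s = ∫ x, H (swirl (V s) x) * Θ x ^ 2)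
    (hGH : ∀ s, GH s = ∫ x, deriv (deriv H) (swirl (V s) x) * ‖gradient (swirl (V s)) x‖ ^ 2 * Θ x ^ 2)
    (hPf : ∀ s, Pf s = ∫ x, H (swirl (V s) x) * ‖gradient Θ x‖ ^ 2)
    (hTV : ∀ s, TV s = ∫ x, H (swirl (V s) x) * ⟪V s x, gradient (fun y => Θ y ^ 2) x⟫)
    (hTb : ∀ s, Tb s = ∫ x, 2 / cylRadius x * (H (swirl (V s) x) * fderiv ℝ (fun y => Θ y ^ 2) x (eR x))) :
    η t * M t + 1 / 2 * ∫ s in t₁..t, η s * GH s ≤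
      ∫ s in t₁..t, (4 * (η s * Pf s) + η s * TV s + η s * Tb s + |deriv η s| * M s) := by
  -- the cross term functional
  obtain ⟨T₁, hT₁⟩ : ∃ T₁ : ℝ → ℝ, ∀ s, T₁ s = ∫ x, deriv H (swirl (V s) x) *
      ⟪gradient (swirl (V s)) x, gradient (fun y => Θ y ^ 2) x⟫ := ⟨_, fun _ => rfl⟩
  obtain ⟨cM, cGH, cT₁, cPf, cTV, cTb⟩ :=
    continuousOn_swirl_sliceFunctionals hU hSU hUρ hV hH hΘ hΘc hΘU hM hGH hT₁ hPf hTV hTb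
  set K : Set (EuclideanSpace ℝ (Fin 3)) := tsupport Θ with hKdef
  have hK : IsCompact K := hΘc
  have hΘ0 : ∀ x, x ∉ K → Θ x = 0 := fun x hx => image_eq_zero_of_notMem_tsupport hx
  have hgΘ0 : ∀ x, x ∉ K → gradient (fun y => Θ y ^ 2) x = 0 := fun x hx => gradient_sq_eq_zero_of_notMem hx
  have hgΘ0' : ∀ x, x ∉ K → gradient Θ x = 0 := fun x hx => gradient_eq_zero_of_notMem_tsupport hx
  have hIcc : Icc t₁ t ⊆ Ioo lo hi := fun r hr => ⟨lt_of_lt_of_le h1 hr.1, lt_of_le_of_lt hr.2 ht⟩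
  have hH' : ContDiff ℝ 1 (deriv H) := by
    have h2' : ContDiff ℝ (1 + 1) H := by rw [one_add_one_eq_two]; exact hH
    exact h2'.deriv'
  have hΘ2 : ContDiff ℝ 1 fun y => Θ y ^ 2 := hΘ.pow 2
  -- (1) the identity on `[t₁, t]`
  have hid := swirl_energy_identity hU hSU hS hUρ hV hH hΘ hΘc hΘU hη h1 h1t ht
  -- (2) its left-hand side is `η(t) M(t)`
  have eL : ∫ x, (H (swirl (V t) x) * η t - H (swirl (V t₁) x) * η t₁) * Θ x ^ 2 = η t * M t := by
    rw [hM t, ← MeasureTheory.integral_const_mul]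
    refine integral_congr_ae (ae_of_all _ fun x => ?_)
    beta_reduce
    rw [hη1]
    ring
  -- (3) slice facts for `s ∈ [t₁, t]`: `∫(H''|∇σ|²Θ² + H'⟪∇σ,∇Θ²⟫) = G_H + T₁`, `-T₁ ≤ ½G_H + 4P`, `M ≥ 0`
  have hslice : ∀ s ∈ Icc t₁ t,
      (∫ x, (deriv (deriv H) (swirl (V s) x) * ‖gradient (swirl (V s)) x‖ ^ 2 * Θ x ^ 2 +
        deriv H (swirl (V s) x) * ⟪gradient (swirl (V s)) x, gradient (fun y => Θ y ^ 2) x⟫)) = GH s + T₁ s ∧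
      -T₁ s ≤ GH s / 2 + 4 * Pf s ∧ 0 ≤ M s := by
    intro s hs
    have hsI : s ∈ Ioo lo hi := hIcc hs
    have hF1 : ContDiffOn ℝ 1 (swirl (V s)) U := (contDiffOn_swirl_slice hSU hV hsI).of_le (by norm_cast)
    have cF : ContinuousOn (swirl (V s)) U := hF1.continuousOn
    have cgF : ContinuousOn (gradient (swirl (V s))) U := continuousOn_gradient_of_contDiffOn hU hF1
    have cΘ2 : Continuous fun y : EuclideanSpace ℝ (Fin 3) => Θ y ^ 2 := hΘ.continuous.pow 2
    have cgΘ : Continuous (gradient Θ) := continuous_gradient_of_contDiff hΘ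
    have cgΘ2 : Continuous (gradient fun y => Θ y ^ 2) := continuous_gradient_of_contDiff hΘ2
    have iGH : Integrable fun x => deriv (deriv H) (swirl (V s) x) * ‖gradient (swirl (V s)) x‖ ^ 2 * Θ x ^ 2 :=
      (continuous_integrable_of_continuousOn_of_eq_zero hU hK hΘU
        ((((hH'.continuous_deriv le_rfl).comp_continuousOn cF).mul (cgF.norm.pow 2)).mul cΘ2.continuousOn)
        (fun x hx => by simp [hΘ0 x hx])).2
    have iT₁ : Integrable fun x => deriv H (swirl (V s) x) * ⟪gradient (swirl (V s)) x, gradient (fun y => Θ y ^ 2) x⟫ :=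
      (continuous_integrable_of_continuousOn_of_eq_zero hU hK hΘU
        ((hH'.continuous.comp_continuousOn cF).mul (cgF.inner cgΘ2.continuousOn))
        (fun x hx => by
          show deriv H (swirl (V s) x) * ⟪gradient (swirl (V s)) x, gradient (fun y => Θ y ^ 2) x⟫ = 0
          rw [hgΘ0 x hx, inner_zero_right, mul_zero])).2
    have iPf : Integrable fun x => H (swirl (V s) x) * ‖gradient Θ x‖ ^ 2 :=
      (continuous_integrable_of_continuousOn_of_eq_zero hU hK hΘU
        ((hH.continuous.comp_continuousOn cF).mul (cgΘ.norm.pow 2).continuousOn)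
        (fun x hx => by simp [hgΘ0' x hx])).2
    refine ⟨?_, ?_, ?_⟩
    · rw [hGH s, hT₁ s, ← integral_add iGH iT₁]
    · rw [hT₁ s, hGH s, hPf s, ← MeasureTheory.integral_neg, ← MeasureTheory.integral_div,
        ← MeasureTheory.integral_const_mul,
        ← integral_add (iGH.div_const _) (iPf.const_mul _)]
      refine integral_mono iT₁.neg ((iGH.div_const _).add (iPf.const_mul _)) fun x => ?_
      exact neg_cross_le_pointwise hH0 hH2 hκ hΘ (swirl (V s)) x
    · rw [hM s]
      exact integral_nonneg fun x => mul_nonneg (hH0 _) (sq_nonneg _)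
  -- (4) interval integrability on `[t₁, t]` of all slice functionals
  have hsub : uIcc t₁ t ⊆ Ioo lo hi := by
    rw [uIcc_of_le h1t]
    exact hIcc
  have iiM : IntervalIntegrable M volume t₁ t := (cM.mono hsub).intervalIntegrable
  have iiGH : IntervalIntegrable GH volume t₁ t := (cGH.mono hsub).intervalIntegrable
  have iiT₁ : IntervalIntegrable T₁ volume t₁ t := (cT₁.mono hsub).intervalIntegrable
  have iiPf : IntervalIntegrable Pf volume t₁ t := (cPf.mono hsub).intervalIntegrable
  have iiTV : IntervalIntegrable TV volume t₁ t := (cTV.mono hsub).intervalIntegrable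
  have iiTb : IntervalIntegrable Tb volume t₁ t := (cTb.mono hsub).intervalIntegrable
  have cη : Continuous η := hη.continuous
  have cη' : Continuous (deriv η) := hη.continuous_deriv le_rfl
  have iiη : ∀ {f : ℝ → ℝ}, IntervalIntegrable f volume t₁ t → IntervalIntegrable (fun s => η s * f s) volume t₁ t :=
    fun hf => hf.continuousOn_mul cη.continuousOn
  -- (5) the identity's integrand, rewritten, and its majorant
  have eI : ∀ s ∈ Icc t₁ t, η s *
        (-(∫ x, (deriv (deriv H) (swirl (V s) x) * ‖gradient (swirl (V s)) x‖ ^ 2 * Θ x ^ 2 +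
            deriv H (swirl (V s) x) * ⟪gradient (swirl (V s)) x, gradient (fun y => Θ y ^ 2) x⟫)) +
          (∫ x, H (swirl (V s) x) * ⟪V s x, gradient (fun y => Θ y ^ 2) x⟫) +
          ∫ x, 2 / cylRadius x * (H (swirl (V s) x) * fderiv ℝ (fun y => Θ y ^ 2) x (eR x))) +
        deriv η s * ∫ x, H (swirl (V s) x) * Θ x ^ 2 =
      -(η s * GH s) - η s * T₁ s + η s * TV s + η s * Tb s + deriv η s * M s := by
    intro s hs
    rw [(hslice s hs).1, ← hTV s, ← hTb s, ← hM s]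
    ring
  have hmaj : ∀ s ∈ Icc t₁ t,
      -(η s * GH s) - η s * T₁ s + η s * TV s + η s * Tb s + deriv η s * M s ≤
        -(1 / 2) * (η s * GH s) + (4 * (η s * Pf s) + η s * TV s + η s * Tb s + |deriv η s| * M s) := by
    intro s hs
    obtain ⟨-, hcross, hM0⟩ := hslice s hs
    have h1 : -(η s * T₁ s) ≤ η s * (GH s / 2 + 4 * Pf s) := by
      have := mul_le_mul_of_nonneg_left hcross (hη0 s)
      linarith
    have h2 : deriv η s * M s ≤ |deriv η s| * M s := mul_le_mul_of_nonneg_right (le_abs_self _) hM0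
    nlinarith [h1, h2]
  -- (6) integrate
  have iLHS : IntervalIntegrable (fun s => -(η s * GH s) - η s * T₁ s + η s * TV s + η s * Tb s + deriv η s * M s)
      volume t₁ t :=
    ((((iiη iiGH).neg.sub (iiη iiT₁)).add (iiη iiTV)).add (iiη iiTb)).add (iiM.continuousOn_mul cη'.continuousOn)
  have iRHS₂ : IntervalIntegrable (fun s => 4 * (η s * Pf s) + η s * TV s + η s * Tb s + |deriv η s| * M s) volume t₁ t :=
    ((((iiη iiPf).const_mul 4).add (iiη iiTV)).add (iiη iiTb)).add (iiM.continuousOn_mul cη'.abs.continuousOn)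
  have iRHS : IntervalIntegrable (fun s => -(1 / 2) * (η s * GH s) +
      (4 * (η s * Pf s) + η s * TV s + η s * Tb s + |deriv η s| * M s)) volume t₁ t :=
    ((iiη iiGH).const_mul _).add iRHS₂
  have hint_id : ∫ s in t₁..t, (η s *
        (-(∫ x, (deriv (deriv H) (swirl (V s) x) * ‖gradient (swirl (V s)) x‖ ^ 2 * Θ x ^ 2 +
            deriv H (swirl (V s) x) * ⟪gradient (swirl (V s)) x, gradient (fun y => Θ y ^ 2) x⟫)) +
          (∫ x, H (swirl (V s) x) * ⟪V s x, gradient (fun y => Θ y ^ 2) x⟫) +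
          ∫ x, 2 / cylRadius x * (H (swirl (V s) x) * fderiv ℝ (fun y => Θ y ^ 2) x (eR x))) +
        deriv η s * ∫ x, H (swirl (V s) x) * Θ x ^ 2) =
      ∫ s in t₁..t, (-(η s * GH s) - η s * T₁ s + η s * TV s + η s * Tb s + deriv η s * M s) := by
    refine intervalIntegral.integral_congr fun s hs => ?_
    rw [uIcc_of_le h1t] at hs
    exact eI s hs
  have hmono : ∫ s in t₁..t, (-(η s * GH s) - η s * T₁ s + η s * TV s + η s * Tb s + deriv η s * M s) ≤
      ∫ s in t₁..t, (-(1 / 2) * (η s * GH s) +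
        (4 * (η s * Pf s) + η s * TV s + η s * Tb s + |deriv η s| * M s)) :=
    intervalIntegral.integral_mono_on h1t iLHS iRHS hmaj
  have hsplit : ∫ s in t₁..t, (-(1 / 2) * (η s * GH s) +
        (4 * (η s * Pf s) + η s * TV s + η s * Tb s + |deriv η s| * M s)) =
      -(1 / 2) * (∫ s in t₁..t, η s * GH s) +
        ∫ s in t₁..t, (4 * (η s * Pf s) + η s * TV s + η s * Tb s + |deriv η s| * M s) := by
    rw [intervalIntegral.integral_add ((iiη iiGH).const_mul _) iRHS₂, intervalIntegral.integral_const_mul]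
  have hmain : η t * M t = ∫ s in t₁..t, (-(η s * GH s) - η s * T₁ s + η s * TV s + η s * Tb s + deriv η s * M s) := by
    rw [← eL, hid, hint_id]
  rw [hsplit] at hmono
  linarith [hmono, hmain]

end Slice

end Seregin2020

end Literature.Analysis.FluidPDE
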